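import Mathlib.MeasureTheory.Group.LIntegral
import Mathlib.MeasureTheory.Measure.Prod
import HarnessLib

/-!
# UV3 ∕ N08 supply — BRANCH (MÖBIUS) EXPANSION, FILE 1: the finset kernels (inclusion–exclusion, MUTE-SITE PAIRING, regrouping) and the ONE-SLOT FUBINI KERNEL

LEAD seat `ym-ust-19936-w1` (gen 12) of crux stmt-QuantumFields-19936 `UnitScaleTilt.HistoryTailL`, cell `ym3-torus`; design note
`Cruxes/HistoryTailL/HTopBranchExpansion.md` (19936 evidence #49).  RECORD CURRENCY (★★OWNER WORDS 84∕85): RECORD-INDEPENDENT KINEMATICS — the abstract kernels of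
a K-uniform bound `ι_{j,K} ≤ e^{c}•dU_K` for product Haar measure pushed through the guarded block averagings `avT3` («hTop»); read by NO row and NO concluder of the
χ-record `AlphaInputsT3ACv4RecChi` (the 19936 display); SUPPLY for NODE O B3 (A-rows `fibre55Win`∕`fibre57LowOn`, if a fibrewise mass envelope is wanted) and for
Track A's N08 node (k-uniform masses).  Nothing of hTop, of the record, of `HistoryTailL` or of rung R3 is proved here; rung R3 = SU(2) YM₃ on T³ — NOT d = 4, NOT
infinite volume, NOT a mass gap, NOT the Clay problem.
* §1 `∏_{σ∈T}(1 − e σ) = Σ_{t⊆T} (−1)^{|t|} ∏_{σ∈t} e σ`; ★ an alternating sum over the subsets of `s` VANISHES when the summand is invariant under inserting one fixed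
  `σ ∈ s` (the MUTE-SITE PAIRING — the combinatorial half of lemma (M) of the note; `Finset.sum_involution` with `s' ↦ s' △ {σ}`); the regrouping
  `Σ_{s'} Σ_{t ⊆ s'ᶜ} h (s'∪t) s' = Σ_{s} Σ_{s'⊆s} h s s'`.
* §2 ★ THE ONE-SLOT FUBINI KERNEL (the analytic half of (M)): on `μ' ⊗ η` with `η` left- and right-invariant on a measurable group,
  `∫ Ψ(ω', a(ω')·X(ω')·g·b(ω')) = ∫ Ψ(ω', g)` for EVERY measurable `X` — a product containing one private Haar factor is Haar whatever the other (branch-dependent)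
  factor is; hence two branches `X₁`, `X₂` give equal integrals.
File 2 (`…UV3BranchExpansionDomination`) proves the expansion (E) and the domination letter `μ.map A ≤ (Σ_{s∉𝓜} 2^{|s|}·w s) • ν` over these kernels.
[folklore] finite combinatorics and measure theory; 0 `sorry`, 0 `def`, 0 `instance`; standard axioms.
-/

set_option autoImplicit false

noncomputable section

open MeasureTheory Set Function
open scoped ENNReal

namespace Summit.QuantumFields.YangMills.Theorems.UV3BranchExpansionKernels

/-! ## §1 Finset algebra: inclusion–exclusion of a product of `1 − e`, the mute pairing, the regrouping -/

section FinsetAlgebra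

variable {ι : Type*} [DecidableEq ι]

/-- `∏_{σ∈T} (1 − e σ) = Σ_{t ⊆ T} (−1)^{|t|}·∏_{σ∈t} e σ` (Mathlib `Finset.prod_add` with `f = −e`, `g = 1`). [folklore] -/
theorem prod_one_sub_eq_sum_powerset (T : Finset ι) (e : ι → ℝ) :
    ∏ σ ∈ T, (1 - e σ) = ∑ t ∈ T.powerset, (-1 : ℝ) ^ t.card * ∏ σ ∈ t, e σ := by
  have h : ∀ σ ∈ T, (1 - e σ) = (-e σ) + 1 := fun σ _ => by ring
  rw [Finset.prod_congr rfl h, Finset.prod_add]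
  refine Finset.sum_congr rfl fun t _ => ?_
  rw [Finset.prod_const_one, mul_one]
  have hneg : ∀ σ ∈ t, -e σ = (-1 : ℝ) * e σ := fun σ _ => by ring
  rw [Finset.prod_congr rfl hneg, Finset.prod_mul_distrib, Finset.prod_const]

/-- **THE MUTE-SITE PAIRING KILLS THE ALTERNATING SUM**: if `σ ∈ s` and the summand `f` does not see whether `σ` is switched on (`f (insert σ s') = f s'` for every
`s' ⊆ s` with `σ ∉ s'`), then `Σ_{s'⊆s} (−1)^{|s∖s'|} f s' = 0` (the involution `s' ↦ s' △ {σ}` on `s.powerset`). [folklore] -/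
theorem alternatingSum_powerset_eq_zero_of_pairing (s : Finset ι) (f : Finset ι → ℝ) {σ : ι} (hσ : σ ∈ s)
    (hpair : ∀ s' ⊆ s, σ ∉ s' → f (insert σ s') = f s') :
    ∑ s' ∈ s.powerset, (-1 : ℝ) ^ (s \ s').card * f s' = 0 := by
  -- the involution: remove `σ` if present, insert it otherwise
  refine Finset.sum_involution (fun s' _ => if σ ∈ s' then s'.erase σ else insert σ s') ?_ ?_ ?_ ?_
  · -- the two paired terms cancel
    intro s' hs'
    have hsub : s' ⊆ s := Finset.mem_powerset.1 hs'
    by_cases hmem : σ ∈ s'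
    · simp only [hmem, if_true]
      have hsub' : s'.erase σ ⊆ s := (Finset.erase_subset σ s').trans hsub
      have hnot : σ ∉ s'.erase σ := Finset.notMem_erase σ s'
      have hins : insert σ (s'.erase σ) = s' := Finset.insert_erase hmem
      have hf : f s' = f (s'.erase σ) := by rw [← hpair (s'.erase σ) hsub' hnot, hins]
      have hcard : (s \ s'.erase σ).card = (s \ s').card + 1 := by
        rw [show s \ s'.erase σ = insert σ (s \ s') by
          ext τ
          simp only [Finset.mem_sdiff, Finset.mem_erase, Finset.mem_insert, ne_eq, not_and]
          constructor
          · rintro ⟨hτs, hτ⟩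
            by_cases hτσ : τ = σ
            · exact Or.inl hτσ
            · exact Or.inr ⟨hτs, fun hτs' => hτ hτσ hτs'⟩
          · rintro (hτσ | ⟨hτs, hτs'⟩)
            · exact ⟨hτσ ▸ hσ, fun h _ => h hτσ⟩
            · exact ⟨hτs, fun _ h => hτs' h⟩]
        rw [Finset.card_insert_of_notMem]
        simp only [Finset.mem_sdiff, not_and, not_not]
        exact fun _ => hmem
      rw [hf, hcard, pow_succ]
      ring
    · simp only [hmem, if_false]
      have hf : f (insert σ s') = f s' := hpair s' hsub hmem
      have hcard : (s \ s').card = (s \ insert σ s').card + 1 := by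
        rw [show s \ s' = insert σ (s \ insert σ s') by
          ext τ
          simp only [Finset.mem_sdiff, Finset.mem_insert, not_or]
          constructor
          · rintro ⟨hτs, hτs'⟩
            by_cases hτσ : τ = σ
            · exact Or.inl hτσ
            · exact Or.inr ⟨hτs, hτσ, hτs'⟩
          · rintro (hτσ | ⟨hτs, -, hτs'⟩)
            · exact ⟨hτσ ▸ hσ, hτσ ▸ hmem⟩
            · exact ⟨hτs, hτs'⟩]
        rw [Finset.card_insert_of_notMem]
        simp only [Finset.mem_sdiff, Finset.mem_insert, true_or, not_true_eq_false, and_false, not_false_eq_true]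
      rw [hf, hcard, pow_succ]
      ring
  · -- the involution has no fixed point
    intro s' _ _
    by_cases hmem : σ ∈ s'
    · simp only [hmem, if_true]
      exact fun h => (Finset.notMem_erase σ s') (h.symm ▸ hmem)
    · simp only [hmem, if_false]
      exact fun h => hmem (h ▸ Finset.mem_insert_self σ s')
  · -- it stays inside the powerset
    intro s' hs'
    have hsub : s' ⊆ s := Finset.mem_powerset.1 hs'
    by_cases hmem : σ ∈ s'
    · simp only [hmem, if_true]
      exact Finset.mem_powerset.2 ((Finset.erase_subset σ s').trans hsub)
    · simp only [hmem, if_false]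
      exact Finset.mem_powerset.2 (Finset.insert_subset hσ hsub)
  · -- it is an involution
    intro s' _
    by_cases hmem : σ ∈ s'
    · simp only [hmem, if_true, Finset.notMem_erase, if_false]
      exact Finset.insert_erase hmem
    · simp only [hmem, if_false, Finset.mem_insert_self, if_true]
      exact Finset.erase_insert hmem

/-- **REGROUPING**: summing over the branch set `s'` and then over the extra constrained sites `t ⊆ s'ᶜ` is summing over the constrained set `s` and then over its
subsets `s' ⊆ s` (`s = s' ∪ t`, `t = s ∖ s'`). [folklore] -/
theorem sum_sum_powerset_compl_eq [Fintype ι] (h : Finset ι → Finset ι → ℝ) :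
    ∑ s' : Finset ι, ∑ t ∈ (Finset.univ \ s').powerset, h (s' ∪ t) s' = ∑ s : Finset ι, ∑ s' ∈ s.powerset, h s s' := by
  -- rewrite the right-hand side as a sum over `s'` of the sum over the supersets `s ⊇ s'`
  have hR : ∑ s : Finset ι, ∑ s' ∈ s.powerset, h s s' =
      ∑ s' : Finset ι, ∑ s ∈ Finset.univ.filter (fun s : Finset ι => s' ⊆ s), h s s' := by
    have h1 : ∀ s : Finset ι, ∑ s' ∈ s.powerset, h s s' = ∑ s' : Finset ι, if s' ⊆ s then h s s' else 0 := by
      intro s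
      rw [← Finset.sum_filter]
      congr 1
      ext s'
      simp
    have h2 : ∀ s' : Finset ι, ∑ s ∈ Finset.univ.filter (fun s : Finset ι => s' ⊆ s), h s s' =
        ∑ s : Finset ι, if s' ⊆ s then h s s' else 0 := fun s' => by rw [← Finset.sum_filter]
    simp_rw [h1, h2]
    exact Finset.sum_comm
  rw [hR]
  refine Finset.sum_congr rfl fun s' _ => ?_
  -- the bijection `t ↦ s' ∪ t` between `(univ ∖ s').powerset` and the supersets of `s'`
  refine Finset.sum_nbij' (fun t => s' ∪ t) (fun s => s \ s') ?_ ?_ ?_ ?_ ?_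
  · intro t _
    simp only [Finset.mem_filter, Finset.mem_univ, true_and]
    exact Finset.subset_union_left
  · intro s _
    simp only [Finset.mem_powerset]
    exact Finset.sdiff_subset_sdiff (Finset.subset_univ s) (le_refl s')
  · intro t ht
    have ht' : t ⊆ Finset.univ \ s' := Finset.mem_powerset.1 ht
    have hdis : Disjoint s' t := by
      rw [Finset.disjoint_left]
      intro τ hτ hτt
      exact (Finset.mem_sdiff.1 (ht' hτt)).2 hτ
    exact Finset.union_sdiff_cancel_left hdis
  · intro s hs
    have hsub : s' ⊆ s := (Finset.mem_filter.1 hs).2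
    exact Finset.union_sdiff_of_subset hsub
  · intro t _
    rfl

end FinsetAlgebra

/-! ## §2 The one-slot Fubini kernel: a product with one private Haar factor is Haar, whatever the branch-dependent factor is -/

section OneSlot

variable {G Ω' : Type*} [Group G] [MeasurableSpace G] [MeasurableMul₂ G] (η : Measure G) [SFinite η]
  [η.IsMulLeftInvariant] [η.IsMulRightInvariant] [MeasurableSpace Ω'] (μ' : Measure Ω')

/-- ★★ **THE ONE-SLOT KERNEL**: for a measurable `Ψ : Ω' × G → ℝ≥0∞` and measurable `a, X, b : Ω' → G`,
`∫ Ψ(ω', a(ω')·X(ω')·g·b(ω')) d(μ' ⊗ η)(ω', g) = ∫ Ψ d(μ' ⊗ η)` — the private slot `g` absorbs the factor `X` by left and right invariance of `η` (Tonelli). [folklore] -/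
theorem lintegral_prod_translate_slot_eq (Ψ : Ω' × G → ℝ≥0∞) (hΨ : Measurable Ψ) (a X b : Ω' → G) (ha : Measurable a) (hX : Measurable X)
    (hb : Measurable b) :
    ∫⁻ p, Ψ (p.1, a p.1 * X p.1 * p.2 * b p.1) ∂(μ'.prod η) = ∫⁻ p, Ψ p ∂(μ'.prod η) := by
  have hm : Measurable fun p : Ω' × G => (p.1, a p.1 * X p.1 * p.2 * b p.1) :=
    measurable_fst.prodMk ((((ha.comp measurable_fst).mul (hX.comp measurable_fst)).mul measurable_snd).mul (hb.comp measurable_fst))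
  have hL : ∫⁻ p, Ψ (p.1, a p.1 * X p.1 * p.2 * b p.1) ∂(μ'.prod η) = ∫⁻ ω', ∫⁻ g, Ψ (ω', a ω' * X ω' * g * b ω') ∂η ∂μ' :=
    lintegral_prod (fun p : Ω' × G => Ψ (p.1, a p.1 * X p.1 * p.2 * b p.1)) (hΨ.comp hm).aemeasurable
  have hR : ∫⁻ p, Ψ p ∂(μ'.prod η) = ∫⁻ ω', ∫⁻ g, Ψ (ω', g) ∂η ∂μ' := lintegral_prod Ψ hΨ.aemeasurable
  rw [hL, hR]
  refine lintegral_congr fun ω' => ?_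
  have h1 : ∫⁻ g, Ψ (ω', a ω' * X ω' * g * b ω') ∂η = ∫⁻ g, Ψ (ω', g * b ω') ∂η :=
    lintegral_mul_left_eq_self (μ := η) (fun g => Ψ (ω', g * b ω')) (a ω' * X ω')
  rw [h1]
  exact lintegral_mul_right_eq_self (μ := η) (fun g => Ψ (ω', g)) (b ω')

/-- ★★★ **(M)'s ENGINE — TWO BRANCHES, ONE PRIVATE SLOT, EQUAL INTEGRALS**: if every quantity entering the integrand depends on the branch-dependent factor `X_i`
only through the product `a·X_i·g·b` with a private `η`-distributed slot `g`, then the two branches `X₁`, `X₂` give the same integral. [folklore] -/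
theorem lintegral_prod_translate_slot_eq_of_branches (Ψ : Ω' × G → ℝ≥0∞) (hΨ : Measurable Ψ) (a X₁ X₂ b : Ω' → G) (ha : Measurable a)
    (hX₁ : Measurable X₁) (hX₂ : Measurable X₂) (hb : Measurable b) :
    ∫⁻ p, Ψ (p.1, a p.1 * X₁ p.1 * p.2 * b p.1) ∂(μ'.prod η) = ∫⁻ p, Ψ (p.1, a p.1 * X₂ p.1 * p.2 * b p.1) ∂(μ'.prod η) := by
  rw [lintegral_prod_translate_slot_eq η μ' Ψ hΨ a X₁ b ha hX₁ hb, lintegral_prod_translate_slot_eq η μ' Ψ hΨ a X₂ b ha hX₂ hb]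

end OneSlot

end Summit.QuantumFields.YangMills.Theorems.UV3BranchExpansionKernels

end
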